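import Summits.QuantumFields.YangMills.Theorems.BalabanLadderIRColdPurityDobrushinCorner
import Summits.Ventures.YMGap.RobustBall.BoundaryDecayKR
import Literature.MathematicalPhysics.QuantumLattice.LatticeGaugeDLRLimitPointsProofs
import Literature.MathematicalPhysics.QuantumFieldTheory.Sweep1ShenZhuZhuProofs
import HarnessLib

/-!
# Crux `IR` (stmt-QuantumFields-19354), cold-purity currency: the `SU(2)` COLD-PURITY CORNER THROUGH THE QUARTER DOOR —
# `δᶜ_β(L) ≤ β · 12 L³⌊L/4⌋ · 1024√2 · max(9β, ½)^{⌊(⌊L/4⌋−3)/2⌋}` for every tree coupling `0 ≤ β < 1/9` (`β_W = 2β < 2/9`)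

Helper file (`--supports stmt-QuantumFields-19354`, helper class; no registered stub claimed) of the pooled IR prover
`ym-ir-line-pool-p3` (g6): tier B of `Cruxes/IR/PURITY-CORNER-TRANSPORT-idea3g13.md` for `SU(2)` (fundamental
representation, `fundamentalLatticeRep 2`), with the note's pair door `β_W < 1/6` replaced by the tree's sharper QUARTER
(one-link Kantorovich–Rubinstein modulus) door `β_W < 2/9` of `RobustBall.BoundaryDecayKR`
(`su2_wilson_abs_boundary_sub_integral_le_quarter_dim4`: every finite-volume Wilson distribution with any boundary field
is within `2√2 · K · #Δ · max(9β_W/2, ½)^{⌊D⌋}` of every DLR state on Lipschitz cylinders at depth `D`), and the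
every-group assembly of `BalabanLadderIRColdPurityDobrushin{Window,Corner}` re-run with the pair bound as a parameter:
* §1 `su2_abs_kernel_plaquetteActionObs_sub_le_quarter` — two exteriors of the window kernel differ on the plaquette
  density by `≤ 1024√2 · max(ρ,½)^m` (through a DLR state, which exists by compactness; the density is `2 − 2·` the tree's
  normalised plaquette observable, a Lipschitz cylinder with constant `32`, `isLipschitzCylinder_zdPlaquetteObs`);
* §2 `su2_abs_plaquetteActionObs_sub_le_quarter` — two tori `L³ × T₁`, `L³ × T₂` (`2m+2 < L, T₁, T₂`) agree on the
  plaquette density up to the same bound (local DLR read in `ℤ⁴`, `WilsonFinTorusPeriodicLift`);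
* §3 `abs_actionDefect_le_of_pairBound`, `negLogColdRatio_le_of_pairBound`, `coldDefect_le_negLogColdRatio` (generic),
  **`su2_coldDefect_le_of_quarterDoor`** (`0 ≤ β`, `9β ≤ ρ < 1`, `L ≥ 20` ⇒
  `δᶜ_β(L) ≤ (L·L·L·2⌊L/4⌋·6) · 1024√2 · max(ρ,½)^{⌊(⌊L/4⌋−3)/2⌋} · β`) and **`su2_coldExitAt_corner_of_quarterDoor`**
  (∀ `ρ < 1`, `θ > 0` ∃ `L₀` ∀ `0 ≤ β ≤ ρ/9` ∀ `L ≥ L₀`: `δᶜ_β(L) ≤ θ`).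
READING.  `SU(2)` door `β_W < 2/9 ≈ 0.22`: ×48 over the every-group total-variation door `β_W ≤ 1/216` of the `Corner`
file and past the certified-conditional purity radius `0.022–0.036` of FINITE-BOX-PURITY §9 (i-e″); still ≈ 10× below the
crossover `β_W ≈ 2.2` where the seed `PX(1/24)` is owed.  Price: the constant `1024√2` per pair (instead of `16`) and, for
`β_W > 1/9`, the rate `(9β_W/2)^k → 1⁻` at the door's edge.
HONEST FRAMING.  A strong-coupling FORMAT rung for `SU(2)`, the opposite corner to `ColdExitAt θ`'s `∀ β ≥ β₁ ∃ L`.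
Nothing here proves `BalabanLadder.IR` (0/1), a lattice mass gap, confinement, or the Yang–Mills mass gap (Clay); R4 closes
only the conditional finite-𝕋⁴ rung `BalabanLadder.UV`.
-/

set_option autoImplicit false

noncomputable section

namespace Summit.QuantumFields.YangMills.Cruxes.IR.ColdPurityDobrushin

open MeasureTheory Filter Topology Finset
open scoped NNReal
open Literature.MathematicalPhysics.QuantumFieldTheory hiding ZdEdge
open Literature.MathematicalPhysics.QuantumLattice
open Summit.QuantumFields.YangMills.Cruxes.IR.ColdPurityBridge (coldDefect)
open Summit.Ventures.YMGap.RobustBall (su2_wilson_abs_boundary_sub_integral_le_quarter_dim4)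
/-! ## §1 Two exteriors of the window kernel, `SU(2)`, quarter door -/

section Kernel
/-- The `SU(2)` plaquette action density is `2 − 2 ·` the normalised plaquette observable `(1/2) Re tr U_p` of the tree
(`zdPlaquetteObs`; the two plaquette holonomies agree by definition). -/
theorem su2_plaquetteActionObs_eq (p : ZdPlaquette 4) (U : LGConfig 4 (Matrix.specialUnitaryGroup (Fin 2) ℂ)) :
    plaquetteActionObs (fundamentalRep (Fin 2)) p U =
      2 - 2 * zdPlaquetteObs (d := 4) (fundamentalRep (Fin 2)) p.1 p.2.1.1 p.2.1.2 U := by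
  unfold plaquetteActionObs plaquetteObs zdPlaquetteObs
  have h2 : ((2 : ℕ) : ℝ) = 2 := by norm_num
  rw [h2, ← mul_assoc, mul_inv_cancel₀ (two_ne_zero), one_mul]
  rfl

/-- Links of the plaquette `p` are at sup-distance `≥ m` from every link outside the window of half-width `m` around
the base point of `p`. -/
theorem le_norm_sub_of_not_mem_window (p : ZdPlaquette 4) (m : ℕ)
    {Λ : Finset (Literature.MathematicalPhysics.QuantumLattice.ZdEdge 4)}
    (hΛ : Λ = (Fintype.piFinset fun k => Finset.Icc (p.1 k - m) (p.1 k + m)) ×ˢ (Finset.univ : Finset (Fin 4)))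
    {y : Literature.MathematicalPhysics.QuantumLattice.ZdEdge 4} (hy : y ∈ plaquetteEdges p)
    {z : Literature.MathematicalPhysics.QuantumLattice.ZdEdge 4} (hz : z ∉ Λ) : (m : ℝ) ≤ ‖y.1 - z.1‖ := by
  -- some coordinate of `z.1` is farther than `m` from `p.1`
  have hz' : ∃ k, m < |z.1 k - p.1 k| := by
    by_contra hcon
    simp only [not_exists, not_lt] at hcon
    apply hz
    rw [hΛ, Finset.mem_product]
    refine ⟨Fintype.mem_piFinset.2 fun k => Finset.mem_Icc.2 ?_, Finset.mem_univ _⟩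
    have := hcon k
    rw [abs_le] at this
    constructor <;> omega
  obtain ⟨k, hk⟩ := hz'
  have hyk := coord_bounds_of_mem_plaquetteEdges p hy k
  have h1 : (m : ℤ) ≤ |y.1 k - z.1 k| := by
    rw [le_abs]
    rw [lt_abs] at hk
    rcases hk with hk | hk <;> omega
  have h2 : ((m : ℤ) : ℝ) ≤ ((|y.1 k - z.1 k| : ℤ) : ℝ) := by exact_mod_cast h1
  have h3 : ‖(y.1 - z.1) k‖ ≤ ‖y.1 - z.1‖ := norm_le_pi_norm _ k
  rw [Pi.sub_apply, Int.norm_eq_abs, Int.cast_sub] at h3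
  rw [Int.cast_abs, Int.cast_sub] at h2
  push_cast at h2
  linarith

/-- **Boundary influence on the plaquette density, `SU(2)`, quarter door.**  For tree coupling `β` with `9|β| ≤ ρ < 1`
(`β_W = 2β`, the door of `RobustBall.BoundaryDecayKR`): the kernel means of the plaquette action density `2 − Re tr U_p`
over the window of links within sup-distance `m` of the base point of `p` differ between ANY two exteriors by at most
`1024√2 · max(ρ,½)^m` — each exterior is within `2√2 · 32 · 4 · max(ρ,½)^m` of a DLR state (which exists by compactness)
on the normalised plaquette observable, a Lipschitz cylinder with constant `32` on the four links of `p`. -/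
theorem su2_abs_kernel_plaquetteActionObs_sub_le_quarter {β ρ : ℝ} (hρ : 9 * |β| ≤ ρ) (hρ1 : ρ < 1)
    (p : ZdPlaquette 4) (m : ℕ) {Λ : Finset (Literature.MathematicalPhysics.QuantumLattice.ZdEdge 4)}
    (hΛ : Λ = (Fintype.piFinset fun k => Finset.Icc (p.1 k - m) (p.1 k + m)) ×ˢ (Finset.univ : Finset (Fin 4)))
    (ω η : LGConfig 4 (Matrix.specialUnitaryGroup (Fin 2) ℂ)) :
    |(∫ U, plaquetteActionObs (fundamentalRep (Fin 2)) p U ∂(ymSpecification (d := 4) (fundamentalRep (Fin 2)) β Λ ω)) -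
        ∫ U, plaquetteActionObs (fundamentalRep (Fin 2)) p U ∂(ymSpecification (d := 4) (fundamentalRep (Fin 2)) β Λ η)| ≤
      1024 * Real.sqrt 2 * (max ρ (1 / 2)) ^ m := by
  classical
  haveI : SecondCountableTopology (Matrix (Fin 2) (Fin 2) ℂ) :=
    inferInstanceAs (SecondCountableTopology (Fin 2 → Fin 2 → ℂ))
  haveI : SecondCountableTopology (Matrix.specialUnitaryGroup (Fin 2) ℂ) :=
    Topology.IsEmbedding.subtypeVal.secondCountableTopology
  have hcont : Continuous (fundamentalRep (Fin 2)) := continuous_fundamentalRep (Fin 2)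
  -- a DLR state exists (compactness)
  obtain ⟨μ, hμlim⟩ := infiniteVolumeLimitPoints_nonempty_holds (d := 4) (fundamentalRep (Fin 2)) hcont β
  have hμ : μ ∈ ymGibbsMeasures (d := 4) (fundamentalRep (Fin 2)) β :=
    mem_ymGibbsMeasures_of_mem_infiniteVolumeLimitPoints_holds (d := 4) (fundamentalRep (Fin 2)) hcont hμlim
  -- the quarter-door boundary bound for the normalised plaquette observable, at both exteriors
  have hβW : 9 / 2 * |2 * β| ≤ ρ := by rw [abs_mul, abs_two]; linarith
  have hμ' : μ ∈ ymGibbsMeasures (d := 4) (fundamentalRep (Fin 2)) (2 * β / 2) := by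
    rwa [mul_div_cancel_left₀ β two_ne_zero]
  have hL := isLipschitzCylinder_zdPlaquetteObs (N := 2) (d := 4) p.1 (i := p.2.1.1) (j := p.2.1.2) p.2.2
  have hD : ∀ y ∈ plaquetteEdges ((p.1, ⟨(p.2.1.1, p.2.1.2), p.2.2⟩) : ZdPlaquette 4), ∀ z, z ∉ Λ →
      (m : ℝ) ≤ ‖y.1 - z.1‖ := fun y hy z hz => le_norm_sub_of_not_mem_window p m hΛ hy hz
  have hb : ∀ ξ : LGConfig 4 (Matrix.specialUnitaryGroup (Fin 2) ℂ),
      |(∫ U, zdPlaquetteObs (d := 4) (fundamentalRep (Fin 2)) p.1 p.2.1.1 p.2.1.2 U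
          ∂(ymSpecification (d := 4) (fundamentalRep (Fin 2)) β Λ ξ)) -
        ∫ U, zdPlaquetteObs (d := 4) (fundamentalRep (Fin 2)) p.1 p.2.1.1 p.2.1.2 U ∂μ| ≤
        2 * Real.sqrt 2 * (4 * (2 : ℝ≥0) ^ 3 : ℝ≥0) * 4 * (max ρ (1 / 2)) ^ m := by
    intro ξ
    have key := su2_wilson_abs_boundary_sub_integral_le_quarter_dim4 hβW hρ1 hμ' Λ ξ hL hD
    rw [mul_div_cancel_left₀ β two_ne_zero, Nat.floor_natCast] at key
    refine key.trans ?_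
    have hcard : ((plaquetteEdges ((p.1, ⟨(p.2.1.1, p.2.1.2), p.2.2⟩) : ZdPlaquette 4)).card : ℝ) ≤ 4 := by
      exact_mod_cast card_plaquetteEdges_le _
    have h0 : (0 : ℝ) ≤ 2 * Real.sqrt 2 * (4 * (2 : ℝ≥0) ^ 3 : ℝ≥0) := by positivity
    have hp : (0 : ℝ) ≤ (max ρ (1 / 2)) ^ m := pow_nonneg (le_max_of_le_right (by norm_num)) _
    calc 2 * Real.sqrt 2 * ((4 * (2 : ℝ≥0) ^ 3 : ℝ≥0) : ℝ) *
          ((plaquetteEdges ((p.1, ⟨(p.2.1.1, p.2.1.2), p.2.2⟩) : ZdPlaquette 4)).card : ℝ) * (max ρ (1 / 2)) ^ m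
        = (2 * Real.sqrt 2 * ((4 * (2 : ℝ≥0) ^ 3 : ℝ≥0) : ℝ)) *
            (((plaquetteEdges ((p.1, ⟨(p.2.1.1, p.2.1.2), p.2.2⟩) : ZdPlaquette 4)).card : ℝ) *
              (max ρ (1 / 2)) ^ m) := by ring
      _ ≤ (2 * Real.sqrt 2 * ((4 * (2 : ℝ≥0) ^ 3 : ℝ≥0) : ℝ)) * (4 * (max ρ (1 / 2)) ^ m) :=
          mul_le_mul_of_nonneg_left (mul_le_mul_of_nonneg_right hcard hp) h0
      _ = 2 * Real.sqrt 2 * ((4 * (2 : ℝ≥0) ^ 3 : ℝ≥0) : ℝ) * 4 * (max ρ (1 / 2)) ^ m := by ring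
  -- the density is `2 − 2·(normalised observable)`: linearity against the probability kernels
  have hzc : Continuous (zdPlaquetteObs (d := 4) (fundamentalRep (Fin 2)) p.1 p.2.1.1 p.2.1.2 :
      LGConfig 4 (Matrix.specialUnitaryGroup (Fin 2) ℂ) → ℝ) := by
    have h := continuous_plaquetteObs (fundamentalRep (Fin 2)) hcont p.1 p.2.1.1 p.2.1.2 (G := Matrix.specialUnitaryGroup (Fin 2) ℂ) (d := 4)
    have h2 : (zdPlaquetteObs (d := 4) (fundamentalRep (Fin 2)) p.1 p.2.1.1 p.2.1.2 :
        LGConfig 4 (Matrix.specialUnitaryGroup (Fin 2) ℂ) → ℝ) =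
        fun U => (2 : ℝ)⁻¹ * plaquetteObs (fundamentalRep (Fin 2)) p.1 p.2.1.1 p.2.1.2 U := by
      funext U
      unfold zdPlaquetteObs plaquetteObs
      rw [show ((2 : ℕ) : ℝ) = 2 by norm_num]
      rfl
    rw [h2]
    exact continuous_const.mul h
  have hzb : ∀ U : LGConfig 4 (Matrix.specialUnitaryGroup (Fin 2) ℂ),
      |zdPlaquetteObs (d := 4) (fundamentalRep (Fin 2)) p.1 p.2.1.1 p.2.1.2 U| ≤ 1 := fun U =>
    abs_zdPlaquetteObs_le (fun g => fundamentalRep_mem_unitaryGroup g) _ _ _ U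
  have hlin : ∀ ξ : LGConfig 4 (Matrix.specialUnitaryGroup (Fin 2) ℂ),
      ∫ U, plaquetteActionObs (fundamentalRep (Fin 2)) p U ∂(ymSpecification (d := 4) (fundamentalRep (Fin 2)) β Λ ξ) =
        2 - 2 * ∫ U, zdPlaquetteObs (d := 4) (fundamentalRep (Fin 2)) p.1 p.2.1.1 p.2.1.2 U
          ∂(ymSpecification (d := 4) (fundamentalRep (Fin 2)) β Λ ξ) := by
    intro ξ
    haveI := isProbabilityMeasure_ymSpecification (d := 4) (fundamentalRep (Fin 2)) hcont β Λ ξ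
    simp only [su2_plaquetteActionObs_eq]
    rw [integral_sub (integrable_const _) ((integrable_of_bound hzc.aestronglyMeasurable hzb).const_mul 2),
      integral_const, integral_const_mul]
    simp
  rw [hlin ω, hlin η]
  have e : (2 : ℝ) - 2 * (∫ U, zdPlaquetteObs (d := 4) (fundamentalRep (Fin 2)) p.1 p.2.1.1 p.2.1.2 U
        ∂(ymSpecification (d := 4) (fundamentalRep (Fin 2)) β Λ ω)) -
      (2 - 2 * ∫ U, zdPlaquetteObs (d := 4) (fundamentalRep (Fin 2)) p.1 p.2.1.1 p.2.1.2 U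
        ∂(ymSpecification (d := 4) (fundamentalRep (Fin 2)) β Λ η)) =
      -2 * (((∫ U, zdPlaquetteObs (d := 4) (fundamentalRep (Fin 2)) p.1 p.2.1.1 p.2.1.2 U
          ∂(ymSpecification (d := 4) (fundamentalRep (Fin 2)) β Λ ω)) -
          ∫ U, zdPlaquetteObs (d := 4) (fundamentalRep (Fin 2)) p.1 p.2.1.1 p.2.1.2 U ∂μ) -
        ((∫ U, zdPlaquetteObs (d := 4) (fundamentalRep (Fin 2)) p.1 p.2.1.1 p.2.1.2 U
          ∂(ymSpecification (d := 4) (fundamentalRep (Fin 2)) β Λ η)) -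
          ∫ U, zdPlaquetteObs (d := 4) (fundamentalRep (Fin 2)) p.1 p.2.1.1 p.2.1.2 U ∂μ)) := by ring
  rw [e, abs_mul, abs_neg, abs_two]
  have h2 := (abs_sub _ _).trans (add_le_add (hb ω) (hb η))
  have hconst : ((4 * (2 : ℝ≥0) ^ 3 : ℝ≥0) : ℝ) = 32 := by push_cast; norm_num
  rw [hconst] at h2
  nlinarith [h2, Real.sqrt_nonneg 2, pow_nonneg (le_max_of_le_right (by norm_num : (0:ℝ) ≤ 1/2) : (0:ℝ) ≤ max ρ (1/2)) m]
end Kernel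
/-! ## §2 Two tori through one window, `SU(2)`, quarter door -/

section TwoTori
/-- **One-point torus-size difference, `SU(2)`, quarter door.**  For tree coupling `β` with `9|β| ≤ ρ < 1` and two tori
`L³ × T₁`, `L³ × T₂` with `2m + 2 < L, T₁, T₂`, the Wilson expectations of the plaquette action density at the projections of
one `ℤ⁴` plaquette differ by at most `1024√2 · max(ρ,½)^m` (local DLR read in `ℤ⁴`,
`abs_finTorusExpectation_lift_sub_lift_le`, + `su2_abs_kernel_plaquetteActionObs_sub_le_quarter`). -/
theorem su2_abs_plaquetteActionObs_sub_le_quarter {β ρ : ℝ} (hρ : 9 * |β| ≤ ρ) (hρ1 : ρ < 1)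
    {L T₁ T₂ : ℕ} [NeZero L] [NeZero T₁] [NeZero T₂] {m : ℕ} (hL : 2 * m + 2 < L) (hT₁ : 2 * m + 2 < T₁)
    (hT₂ : 2 * m + 2 < T₂) (p : ZdPlaquette 4) :
    |finTorusExpectation (fundamentalRep (Fin 2)) β
          (fun V : FinTorusSite L L L T₁ × Fin 4 → Matrix.specialUnitaryGroup (Fin 2) ℂ =>
            plaquetteActionObs (fundamentalRep (Fin 2)) p (finTorusLift L T₁ V)) -
        finTorusExpectation (fundamentalRep (Fin 2)) β
          (fun V : FinTorusSite L L L T₂ × Fin 4 → Matrix.specialUnitaryGroup (Fin 2) ℂ =>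
            plaquetteActionObs (fundamentalRep (Fin 2)) p (finTorusLift L T₂ V))| ≤
      1024 * Real.sqrt 2 * (max ρ (1 / 2)) ^ m := by
  haveI : SecondCountableTopology (Matrix (Fin 2) (Fin 2) ℂ) :=
    inferInstanceAs (SecondCountableTopology (Fin 2 → Fin 2 → ℂ))
  haveI : SecondCountableTopology (Matrix.specialUnitaryGroup (Fin 2) ℂ) :=
    Topology.IsEmbedding.subtypeVal.secondCountableTopology
  have hcont : Continuous (fundamentalRep (Fin 2)) := continuous_fundamentalRep (Fin 2)
  obtain ⟨Λ, hΛ⟩ : ∃ Λ : Finset (Literature.MathematicalPhysics.QuantumLattice.ZdEdge 4),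
      Λ = (Fintype.piFinset fun k => Finset.Icc (p.1 k - m) (p.1 k + m)) ×ˢ (Finset.univ : Finset (Fin 4)) :=
    ⟨_, rfl⟩
  exact abs_finTorusExpectation_lift_sub_lift_le (fundamentalRep (Fin 2)) hcont β Λ
    (continuous_plaquetteActionObs (fundamentalRep (Fin 2)) hcont p)
    (abs_plaquetteActionObs_le (fundamentalRep (Fin 2)) (fun g => fundamentalRep_mem_unitaryGroup g) p)
    (isCylinder_plaquetteActionObs (fundamentalRep (Fin 2)) p) (injOn_windowClosure p.1 m p.2 hΛ hL hT₁)
    (injOn_windowClosure p.1 m p.2 hΛ hL hT₂) (su2_abs_kernel_plaquetteActionObs_sub_le_quarter hρ hρ1 p m hΛ)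
end TwoTori
/-! ## §3 Assembly over an arbitrary per-pair bound, and the `SU(2)` corner -/

section Assembly
variable {G : Type} [Group G] [TopologicalSpace G] [IsTopologicalGroup G] [CompactSpace G]
  [MeasurableSpace G] [BorelSpace G]

/-- **The coupling derivative from a per-pair bound**: if every plaquette of the long torus `L³ × 2t` and its image in the
short one have action-density expectations within `ε`, then `|⟨S⟩_{L³×2t} − 2⟨S⟩_{L³×t}| ≤ (L·L·L·2t) · 6 · ε`
(`finTorusExpectation_action_eq_sum` + `sum_comp_timeDouble`; the every-group `abs_actionDefect_le` with the pair bound as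
a parameter). -/
theorem abs_actionDefect_le_of_pairBound (r : LatticeRep G) (β : ℝ) {L t : ℕ} [NeZero L] [NeZero t] [NeZero (2 * t)]
    {ε : ℝ}
    (hpair : ∀ (x : FinTorusSite L L L (2 * t)) (q : {q : Fin 4 × Fin 4 // q.1 < q.2}),
      |finTorusExpectation r.ρ β (fun V : FinTorusSite L L L (2 * t) × Fin 4 → G =>
            (r.N : ℝ) - (r.ρ (finTorusPlaquette V x q.1.1 q.1.2)).trace.re) -
          finTorusExpectation r.ρ β (fun V : FinTorusSite L L L t × Fin 4 → G =>
            (r.N : ℝ) - (r.ρ (finTorusPlaquette V (finTorusProjSite L t (finTorusRepr x)) q.1.1 q.1.2)).trace.re)| ≤ ε) :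
    |finTorusExpectation r.ρ β (finTorusWilsonAction (n₀ := L) (n₁ := L) (n₂ := L) (n₃ := 2 * t) r.ρ) -
        2 * finTorusExpectation r.ρ β (finTorusWilsonAction (n₀ := L) (n₁ := L) (n₂ := L) (n₃ := t) r.ρ)| ≤
      ((L * L * L * (2 * t) : ℕ) : ℝ) * 6 * ε := by
  rw [finTorusExpectation_action_eq_sum, finTorusExpectation_action_eq_sum,
    ← sum_comp_timeDouble (fun x' : FinTorusSite L L L t => ∑ q : {q : Fin 4 × Fin 4 // q.1 < q.2},
      finTorusExpectation r.ρ β (fun V : FinTorusSite L L L t × Fin 4 → G =>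
        (r.N : ℝ) - (r.ρ (finTorusPlaquette V x' q.1.1 q.1.2)).trace.re)),
    ← Finset.sum_sub_distrib]
  simp only [← Finset.sum_sub_distrib]
  calc |∑ x : FinTorusSite L L L (2 * t), ∑ q : {q : Fin 4 × Fin 4 // q.1 < q.2},
          (finTorusExpectation r.ρ β (fun V : FinTorusSite L L L (2 * t) × Fin 4 → G =>
              (r.N : ℝ) - (r.ρ (finTorusPlaquette V x q.1.1 q.1.2)).trace.re) -
            finTorusExpectation r.ρ β (fun V : FinTorusSite L L L t × Fin 4 → G =>
              (r.N : ℝ) - (r.ρ (finTorusPlaquette V (finTorusProjSite L t (finTorusRepr x)) q.1.1 q.1.2)).trace.re))|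
      ≤ ∑ x : FinTorusSite L L L (2 * t), ∑ _q : {q : Fin 4 × Fin 4 // q.1 < q.2}, ε := by
        refine (Finset.abs_sum_le_sum_abs _ _).trans (Finset.sum_le_sum fun x _ => ?_)
        exact (Finset.abs_sum_le_sum_abs _ _).trans (Finset.sum_le_sum fun q _ => hpair x q)
    _ = ((L * L * L * (2 * t) : ℕ) : ℝ) * 6 * ε := by
        have hplanes : Fintype.card {q : Fin 4 × Fin 4 // q.1 < q.2} = 6 := by decide
        simp only [Finset.sum_const, Finset.card_univ, hplanes, nsmul_eq_mul, Fintype.card_prod,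
          Fintype.card_fin]
        push_cast
        ring

/-- **`F_β ≤ (L·L·L·2t) · 6 · ε · β` from a per-pair bound `ε` valid on `[0, β]`** (mean value inequality from
`F_0 = 0`, `hasDerivAt_negLogColdRatio`; the every-group `negLogColdRatio_le` with the pair bound as a parameter). -/
theorem negLogColdRatio_le_of_pairBound (r : LatticeRep G) {β : ℝ} (h0 : 0 ≤ β) {L t : ℕ} [NeZero L] [NeZero t]
    [NeZero (2 * t)] {ε : ℝ}
    (hpair : ∀ b ∈ Set.Icc (0 : ℝ) β, ∀ (x : FinTorusSite L L L (2 * t)) (q : {q : Fin 4 × Fin 4 // q.1 < q.2}),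
      |finTorusExpectation r.ρ b (fun V : FinTorusSite L L L (2 * t) × Fin 4 → G =>
            (r.N : ℝ) - (r.ρ (finTorusPlaquette V x q.1.1 q.1.2)).trace.re) -
          finTorusExpectation r.ρ b (fun V : FinTorusSite L L L t × Fin 4 → G =>
            (r.N : ℝ) - (r.ρ (finTorusPlaquette V (finTorusProjSite L t (finTorusRepr x)) q.1.1 q.1.2)).trace.re)| ≤ ε) :
    -Real.log (wilsonFinTorusPartition r.ρ β L L L (2 * t) / wilsonFinTorusPartition r.ρ β L L L t ^ 2) ≤
      ((L * L * L * (2 * t) : ℕ) : ℝ) * 6 * ε * β := by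
  set C : ℝ := ((L * L * L * (2 * t) : ℕ) : ℝ) * 6 * ε with hC
  set F : ℝ → ℝ := fun b => -Real.log (wilsonFinTorusPartition r.ρ b L L L (2 * t) /
    wilsonFinTorusPartition r.ρ b L L L t ^ 2) with hF
  have hF0 : F 0 = 0 := by
    simp only [hF, wilsonFinTorusPartition_zero, one_pow, div_one, Real.log_one, neg_zero]
  have hderiv : ∀ b ∈ Set.Icc (0 : ℝ) β, HasDerivWithinAt F
      (finTorusExpectation r.ρ b (finTorusWilsonAction (n₀ := L) (n₁ := L) (n₂ := L) (n₃ := 2 * t) r.ρ) -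
        2 * finTorusExpectation r.ρ b (finTorusWilsonAction (n₀ := L) (n₁ := L) (n₂ := L) (n₃ := t) r.ρ))
      (Set.Icc (0 : ℝ) β) b := fun b _ =>
    (hasDerivAt_negLogColdRatio r L t b).hasDerivWithinAt
  have hbound : ∀ b ∈ Set.Ico (0 : ℝ) β,
      ‖finTorusExpectation r.ρ b (finTorusWilsonAction (n₀ := L) (n₁ := L) (n₂ := L) (n₃ := 2 * t) r.ρ) -
        2 * finTorusExpectation r.ρ b (finTorusWilsonAction (n₀ := L) (n₁ := L) (n₂ := L) (n₃ := t) r.ρ)‖ ≤ C := by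
    intro b hb
    rw [Real.norm_eq_abs]
    exact abs_actionDefect_le_of_pairBound r b (hpair b ⟨hb.1, hb.2.le⟩)
  have hmvt := norm_image_sub_le_of_norm_deriv_le_segment' hderiv hbound β (Set.right_mem_Icc.2 h0)
  rw [hF0, sub_zero, Real.norm_eq_abs, sub_zero] at hmvt
  exact (le_abs_self (F β)).trans hmvt

/-- **`δᶜ ≤ F`**: the cold purity defect is at most `F = −log(Z(L³×2t)/Z(L³×t)²)`, `t = ⌊L/4⌋` (`1 − e^{−F} ≤ F`). -/
theorem coldDefect_le_negLogColdRatio (r : LatticeRep G) (β : ℝ) (L : ℕ) :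
    coldDefect r.ρ β L ≤
      -Real.log (wilsonFinTorusPartition r.ρ β L L L (2 * (L / 4)) / wilsonFinTorusPartition r.ρ β L L L (L / 4) ^ 2) := by
  haveI := r.secondCountableTopology
  have hpos : 0 < wilsonFinTorusPartition r.ρ β L L L (2 * (L / 4)) / wilsonFinTorusPartition r.ρ β L L L (L / 4) ^ 2 :=
    div_pos (wilsonFinTorusPartition_pos r.continuous β L L L _)
      (pow_pos (wilsonFinTorusPartition_pos r.continuous β L L L _) 2)
  unfold coldDefect
  set F : ℝ := -Real.log (wilsonFinTorusPartition r.ρ β L L L (2 * (L / 4)) /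
    wilsonFinTorusPartition r.ρ β L L L (L / 4) ^ 2) with hF
  have hexp : wilsonFinTorusPartition r.ρ β L L L (2 * (L / 4)) / wilsonFinTorusPartition r.ρ β L L L (L / 4) ^ 2 =
      Real.exp (-F) := by
    rw [hF, neg_neg, Real.exp_log hpos]
  rw [hexp]
  have h1 := Real.add_one_le_exp (-F)
  linarith

/-- **`SU(2)` COLD-PURITY CORNER THROUGH THE QUARTER DOOR.**  For the fundamental representation of `SU(2)`, every tree
coupling `0 ≤ β` with `9β ≤ ρ < 1` (i.e. `β_W = 2β < 2/9`) and every side `L ≥ 20`: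
`δᶜ_β(L) ≤ (L·L·L·2⌊L/4⌋ · 6 · 1024√2 · max(ρ,½)^{⌊(⌊L/4⌋−3)/2⌋}) · β`.  (FORMAT rung, strong coupling.) -/
theorem su2_coldDefect_le_of_quarterDoor {β ρ : ℝ} (h0 : 0 ≤ β) (hρ : 9 * β ≤ ρ) (hρ1 : ρ < 1) {L : ℕ}
    (hL : 20 ≤ L) :
    coldDefect (fundamentalLatticeRep 2).ρ β L ≤
      ((L * L * L * (2 * (L / 4)) : ℕ) : ℝ) * 6 * (1024 * Real.sqrt 2 * (max ρ (1 / 2)) ^ (((L / 4) - 3) / 2)) * β := by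
  haveI : NeZero L := ⟨by omega⟩
  haveI : NeZero (L / 4) := ⟨by omega⟩
  haveI : NeZero (2 * (L / 4)) := ⟨by omega⟩
  have hk1 : 2 * ((L / 4 - 3) / 2) + 2 < L := by omega
  have hk2 : 2 * ((L / 4 - 3) / 2) + 2 < L / 4 := by omega
  have hk3 : 2 * ((L / 4 - 3) / 2) + 2 < 2 * (L / 4) := by omega
  refine (coldDefect_le_negLogColdRatio (fundamentalLatticeRep 2) β L).trans ?_
  refine negLogColdRatio_le_of_pairBound (fundamentalLatticeRep 2) h0 (t := L / 4) fun b hb x q => ?_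
  have hb9 : 9 * |b| ≤ ρ := by rw [abs_of_nonneg hb.1]; linarith [hb.2]
  have h := su2_abs_plaquetteActionObs_sub_le_quarter hb9 hρ1 (T₁ := 2 * (L / 4)) (T₂ := L / 4) hk1 hk3 hk2
    ((finTorusRepr x, q) : ZdPlaquette 4)
  simp only [plaquetteActionObs_finTorusLift, finTorusProjSite_finTorusRepr] at h
  exact h

/-- A polynomial-times-geometric majorant is eventually small: for `0 < c < 1`, `0 ≤ A` and `θ > 0` there is `L₀` with
`A · (L·L·L·2⌊L/4⌋) · c^{⌊(⌊L/4⌋−3)/2⌋} ≤ θ` for all `L ≥ L₀`. -/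
theorem eventually_volume_mul_pow_le {c A θ : ℝ} (hc0 : 0 < c) (hc1 : c < 1) (hA : 0 ≤ A) (hθ : 0 < θ) :
    ∃ L₀ : ℕ, ∀ L : ℕ, L₀ ≤ L → A * ((L * L * L * (2 * (L / 4)) : ℕ) : ℝ) * c ^ (((L / 4) - 3) / 2) ≤ θ := by
  have hlim : Tendsto (fun j : ℕ => ((j + 1 : ℕ) : ℝ) ^ 4 * c ^ (j + 1)) atTop (𝓝 0) :=
    (tendsto_pow_const_mul_const_pow_of_abs_lt_one 4 (by rwa [abs_of_pos hc0])).comp (tendsto_add_atTop_nat 1)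
  have hlim' : Tendsto (fun j : ℕ => A * (2 * 8 ^ 4) * (c ^ 3)⁻¹ * (((j + 1 : ℕ) : ℝ) ^ 4 * c ^ (j + 1)))
      atTop (𝓝 (A * (2 * 8 ^ 4) * (c ^ 3)⁻¹ * 0)) := hlim.const_mul _
  rw [mul_zero] at hlim'
  obtain ⟨j₀, hj₀⟩ := eventually_atTop.1 ((tendsto_order.1 hlim').2 θ hθ)
  refine ⟨8 * j₀, fun L hL => ?_⟩
  set j : ℕ := L / 8 with hj
  have hjj : j₀ ≤ j := by omega
  have hb := (hj₀ j hjj).le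
  have hc3 : 0 < c ^ 3 := pow_pos hc0 3
  have hLj : (L : ℝ) ≤ 8 * ((j + 1 : ℕ) : ℝ) := by
    have : L ≤ 8 * (j + 1) := by omega
    exact_mod_cast this
  have ht : ((2 * (L / 4) : ℕ) : ℝ) ≤ 2 * L := by
    have : 2 * (L / 4) ≤ 2 * L := by omega
    exact_mod_cast this
  have hk : c ^ (((L / 4) - 3) / 2) ≤ (c ^ 3)⁻¹ * c ^ (j + 1) := by
    have hle : j + 1 ≤ ((L / 4) - 3) / 2 + 3 := by omega
    have h1 : c ^ (((L / 4) - 3) / 2 + 3) ≤ c ^ (j + 1) := pow_le_pow_of_le_one hc0.le hc1.le hle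
    rw [pow_add] at h1
    rw [le_inv_mul_iff₀ hc3]
    linarith
  have hL0 : (0 : ℝ) ≤ L := Nat.cast_nonneg _
  have hvol : ((L * L * L * (2 * (L / 4)) : ℕ) : ℝ) ≤ 2 * (8 * ((j + 1 : ℕ) : ℝ)) ^ 4 := by
    rw [Nat.cast_mul, Nat.cast_mul, Nat.cast_mul]
    have h3 : (L : ℝ) * L * L ≤ (8 * ((j + 1 : ℕ) : ℝ)) ^ 3 := by
      have := pow_le_pow_left₀ hL0 hLj 3
      nlinarith [this]
    have ht' : ((2 * (L / 4) : ℕ) : ℝ) ≤ 2 * (8 * ((j + 1 : ℕ) : ℝ)) := ht.trans (by linarith)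
    calc (L : ℝ) * L * L * ((2 * (L / 4) : ℕ) : ℝ) ≤ (8 * ((j + 1 : ℕ) : ℝ)) ^ 3 * (2 * (8 * ((j + 1 : ℕ) : ℝ))) :=
          mul_le_mul h3 ht' (Nat.cast_nonneg _) (by positivity)
      _ = 2 * (8 * ((j + 1 : ℕ) : ℝ)) ^ 4 := by ring
  have hpk : (0 : ℝ) ≤ c ^ (((L / 4) - 3) / 2) := pow_nonneg hc0.le _
  calc A * ((L * L * L * (2 * (L / 4)) : ℕ) : ℝ) * c ^ (((L / 4) - 3) / 2)
      ≤ A * (2 * (8 * ((j + 1 : ℕ) : ℝ)) ^ 4) * ((c ^ 3)⁻¹ * c ^ (j + 1)) := by gcongr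
    _ = A * (2 * 8 ^ 4) * (c ^ 3)⁻¹ * (((j + 1 : ℕ) : ℝ) ^ 4 * c ^ (j + 1)) := by ring
    _ ≤ θ := hb

/-- **UNIFORM `SU(2)` CORNER THROUGH THE QUARTER DOOR**: for every `ρ < 1` and `θ > 0` there is an explicit `L₀` (depending
on `ρ`) such that `δᶜ_β(L) ≤ θ` for every tree coupling `0 ≤ β ≤ ρ/9` (`β_W ≤ 2ρ/9 < 2/9`) and every `L ≥ L₀` —
`ColdPurityBridge.coldExit_uniform_of_strongCoupling`'s shape for `SU(2)` on the window `β_W < 2/9` instead of the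
cluster-expansion radius.  (FORMAT rung; opposite corner to `ColdExitAt`.) -/
theorem su2_coldExitAt_corner_of_quarterDoor {ρ : ℝ} (hρ1 : ρ < 1) {θ : ℝ} (hθ : 0 < θ) :
    ∃ L₀ : ℕ, ∀ β : ℝ, 0 ≤ β → 9 * β ≤ ρ → ∀ L : ℕ, L₀ ≤ L → coldDefect (fundamentalLatticeRep 2).ρ β L ≤ θ := by
  have hc0 : 0 < max ρ (1 / 2) := lt_max_of_lt_right (by norm_num)
  have hc1 : max ρ (1 / 2) < 1 := max_lt hρ1 (by norm_num)
  obtain ⟨L₀, hL₀⟩ := eventually_volume_mul_pow_le (A := 6 * (1024 * Real.sqrt 2) * (1 / 9)) hc0 hc1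
    (by positivity) hθ
  refine ⟨max L₀ 20, fun β h0 hβ L hL => ?_⟩
  have hmain := su2_coldDefect_le_of_quarterDoor h0 hβ hρ1 (le_trans (le_max_right _ _) hL)
  refine hmain.trans (le_trans ?_ (hL₀ L (le_trans (le_max_left _ _) hL)))
  have hβ9 : β ≤ 1 / 9 := by
    have : ρ < 1 := hρ1
    linarith
  have hV : (0 : ℝ) ≤ ((L * L * L * (2 * (L / 4)) : ℕ) : ℝ) := Nat.cast_nonneg _
  have hP : (0 : ℝ) ≤ (max ρ (1 / 2)) ^ (((L / 4) - 3) / 2) := pow_nonneg hc0.le _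
  have hsq : (0 : ℝ) ≤ Real.sqrt 2 := Real.sqrt_nonneg 2
  have e : ((L * L * L * (2 * (L / 4)) : ℕ) : ℝ) * 6 * (1024 * Real.sqrt 2 * (max ρ (1 / 2)) ^ (((L / 4) - 3) / 2)) * β =
      (6 * (1024 * Real.sqrt 2) * β) * ((L * L * L * (2 * (L / 4)) : ℕ) : ℝ) * (max ρ (1 / 2)) ^ (((L / 4) - 3) / 2) := by
    ring
  rw [e]
  have hcoef : 6 * (1024 * Real.sqrt 2) * β ≤ 6 * (1024 * Real.sqrt 2) * (1 / 9) :=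
    mul_le_mul_of_nonneg_left hβ9 (by positivity)
  exact mul_le_mul_of_nonneg_right (mul_le_mul_of_nonneg_right hcoef hV) hP
end Assembly

end Summit.QuantumFields.YangMills.Cruxes.IR.ColdPurityDobrushin

end
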